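import Summits.Ventures.CertifiedArithmetic.LowPrec.OptTreeRZFormats
import Summits.Ventures.CertifiedArithmetic.LowPrec.OptTreeRZWitness
import Summits.Ventures.CertifiedArithmetic.LowPrec.OptRegisters

/-!
# The truncation tree law in the formats (II): the round-toward-zero witness is format data

HONEST FRAMING (venture CertifiedArithmetic / cell `pub-lowprec`): certified error envelopes and
provably optimal rounding/accumulation schemes for low-precision formats under stated cost models;
every table by two implementations; no hardware or vendor claims.

Continuation of `OptTreeRZFormats.lean` (RZ bridge `exists_roundDown_agreeing`, transfer
`eval_eq_eval_rz`, T7(b) in every format). Here T7(c)/(d) of `OptTreeRZWitness` in the formats: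
* `rz_witness_attains_format`: for every format `α`, tree `t` and scale `2^E` with
  `qexp α + p(height t+1) ≤ E + 1` and `2^E·N_t(u_α) ≤ maxRat α`, the opt witness `witRZ u 2^E t`
  consists of nonnegative VALUES OF `α` and the format's `roundTowardZero` evaluation under-estimates
  it by EXACTLY `(1 - 1/N_t)·exact`;
* `rz_sequential_factor`: on the sequential tree `N = M(v)`, so recursive truncated summation of
  nonnegative `α`-data has exact worst case `(n-1)v_α/(1+(n-1)v_α)` whenever the witness fits;
* `rz_witness_attains_at`: the opt witness at ANY admissible scale `2^E`
  (`emin + p(height+1) ≤ E + 1`, one binade below the opt seat's fixed choice included), abstract;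
* `treeN_le_of_height`, `rz_attained_of_height_le` and the HEIGHT TABLE (by `decide`, at the
  lowest admissible scale): the RZ witness is format data in E2M1 for every tree of height `≤ 1`,
  E3M2 `≤ 2`, E4M3 `≤ 3`, E5M2 `≤ 9`, binary16 `≤ 2`, bfloat16 `≤ 31`, binary32 `≤ 10` (E2M3: even
  height 1 does not fit — no row); `rz_height_table_ceilings`;
* kernel replay (E4M3, `v = 15/128`): `rz(32 + 15/4) = 32`, the two-leaf witness.
-/

namespace Summit.Ventures.CertifiedArithmetic.LowPrec.Opt

open Literature.ComputerArithmetic.JeannerodRump2018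
open Literature.ComputerArithmetic.JeannerodRump2018.SumTree
open Literature.ComputerArithmetic.FloatingPoint
open Literature.ComputerArithmetic.FloatingPoint.MiniFloat

/-! ## T7(c) at an arbitrary admissible scale (abstract), then in the formats -/

/-- Every leaf of a tree with nonnegative leaves is at most the exact sum. -/
theorem le_exact_of_mem_leaves : ∀ t : SumTree, (∀ x ∈ leaves t, 0 ≤ x) →
    ∀ x ∈ leaves t, x ≤ exact t
  | .leaf y, _, x, hx => by simp [leaves] at hx; simp [exact, hx]
  | .node l r, h, x, hx => by
      have hl : ∀ x ∈ leaves l, 0 ≤ x := fun x hx => h x (by simp [leaves, hx])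
      have hr : ∀ x ∈ leaves r, 0 ≤ x := fun x hx => h x (by simp [leaves, hx])
      simp only [exact]
      simp only [leaves, List.mem_append] at hx
      rcases hx with hx | hx
      · linarith [le_exact_of_mem_leaves l hl x hx, exact_nonneg_of_leaves r hr]
      · linarith [le_exact_of_mem_leaves r hr x hx, exact_nonneg_of_leaves l hl]

/-- T7(c) AT ANY ADMISSIBLE SCALE (the opt seat's `rz_witness_attains` fixes `S = 2^(emin+p(h+1))`;
the argument works verbatim for every `S = 2^E` with `emin + p·(height t + 1) ≤ E + 1`, one binade
lower included): the witness `witRZ u 2^E t` consists of nonnegative floats, sums to `2^E·N_t`,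
evaluates to `2^E` under every round-down map, and under-estimates by exactly `(1 - 1/N_t)·exact`. -/
theorem rz_witness_attains_at {p : ℕ} {emin : ℤ} {fl : ℚ → ℚ} (hp : 1 ≤ p)
    (hfl : IsRoundDownNonneg p emin fl) (t : SumTree) {E : ℤ}
    (hE : emin + (p : ℤ) * ((height t + 1 : ℕ) : ℤ) ≤ E + 1) :
    (∀ x ∈ leaves (witRZ (unitRoundoff p) ((2 : ℚ) ^ E) t), IsFloat p emin x ∧ 0 ≤ x) ∧
      exact (witRZ (unitRoundoff p) ((2 : ℚ) ^ E) t) = (2 : ℚ) ^ E * treeN (unitRoundoff p) t ∧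
      eval fl (witRZ (unitRoundoff p) ((2 : ℚ) ^ E) t) = (2 : ℚ) ^ E ∧
      exact (witRZ (unitRoundoff p) ((2 : ℚ) ^ E) t) - eval fl (witRZ (unitRoundoff p) ((2 : ℚ) ^ E) t)
        = (1 - 1 / treeN (unitRoundoff p) t) * exact (witRZ (unitRoundoff p) ((2 : ℚ) ^ E) t) := by
  set u := unitRoundoff p with hu
  set S := (2 : ℚ) ^ E with hS
  have hu0 : 0 < u := by rw [hu]; unfold unitRoundoff; positivity
  have hu1 := unitRoundoff_le_one p
  have hS0 : 0 < S := zpow_pos (by norm_num) _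
  have hE0 : emin + p ≤ E + 1 := by push_cast at hE; nlinarith
  have hleaves : ∀ x ∈ leaves (witRZ u S t), IsFloat p emin x ∧ 0 ≤ x := by
    intro x hx
    rcases mem_leaves_witRZ u S t x hx with rfl | ⟨j, hj1, hj2, rfl⟩
    · exact ⟨Literature.ComputerArithmetic.LangeRump2018.isFloat_zpow hp hE0, hS0.le⟩
    · refine ⟨isFloat_light _ j ?_, ?_⟩
      · push_cast at hE ⊢
        have : (p : ℤ) * j ≤ p * height t := by exact_mod_cast Nat.mul_le_mul_left p hj2
        nlinarith
      · have : 0 ≤ 2 - 2 * u := by linarith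
        exact mul_nonneg (mul_nonneg this hS0.le) (pow_nonneg hu0.le _)
  have hexact := exact_witRZ u S t
  have heval : eval fl (witRZ u S t) = S := by
    refine eval_witRZ u S (N := height t) (roundDown_absorb_spine hp hfl hE0) ?_ t le_rfl
    intro j hj
    refine roundDown_absorb_light hp hfl _ j ?_
    push_cast at hE ⊢
    have : (p : ℤ) * j + p ≤ p * height t := by
      have := Nat.mul_le_mul_left p (Nat.succ_le_of_lt hj)
      push_cast [Nat.succ_eq_add_one, mul_add] at this ⊢; linarith
    nlinarith
  refine ⟨hleaves, hexact, heval, ?_⟩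
  rw [hexact, heval]
  have hN : 1 ≤ treeN u t := one_le_treeN hu0.le hu1 t
  have hN0 : treeN u t ≠ 0 := ne_of_gt (lt_of_lt_of_le one_pos hN)
  field_simp

/-- **T7(c) IN FORMAT `α` AT SCALE `2^E`**: with `u = u_α`, if `qexp α + p·(height t + 1) ≤ E + 1`
and `2^E·N_t(u) ≤ maxRat α` then the opt witness `witRZ u 2^E t` consists of nonnegative VALUES OF
`α`, its exact sum is `2^E·N_t`, the format's round-toward-zero evaluation of it is `2^E`, and so it
under-estimates by EXACTLY `(1 - 1/N_t)·exact`. -/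
theorem rz_witness_attains_format (α : Format) (t : SumTree) {E : ℤ}
    (hE : α.qexp + ((α.manBits + 1 : ℕ) : ℤ) * ((height t + 1 : ℕ) : ℤ) ≤ E + 1)
    (hrange : (2 : ℚ) ^ E * treeN (unitRoundoff (α.manBits + 1)) t ≤ α.maxRat) :
    let u := unitRoundoff (α.manBits + 1)
    (∀ x ∈ leaves (witRZ u ((2 : ℚ) ^ E) t), (∃ y : MiniFloat α, y.toRat = x) ∧ 0 ≤ x) ∧
      exact (witRZ u ((2 : ℚ) ^ E) t) = (2 : ℚ) ^ E * treeN u t ∧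
      eval (fun y => (roundTowardZero α y).toRat) (witRZ u ((2 : ℚ) ^ E) t) = (2 : ℚ) ^ E ∧
      exact (witRZ u ((2 : ℚ) ^ E) t) - eval (fun y => (roundTowardZero α y).toRat) (witRZ u ((2 : ℚ) ^ E) t)
        = (1 - 1 / treeN u t) * exact (witRZ u ((2 : ℚ) ^ E) t) := by
  intro u
  obtain ⟨fl, hfl, hagree⟩ := exists_roundDown_agreeing α
  obtain ⟨hleaves, hexact, heval, hatt⟩ := rz_witness_attains_at (p := α.manBits + 1) (by omega) hfl t hE
  have hrange' : exact (witRZ u ((2 : ℚ) ^ E) t) ≤ α.maxRat := by rw [hexact]; exact hrange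
  have htr := eval_eq_eval_rz hfl hagree (witRZ u ((2 : ℚ) ^ E) t) hleaves hrange'
  refine ⟨fun x hx => ⟨?_, (hleaves x hx).2⟩, hexact, by rw [← htr]; exact heval, by rw [← htr]; exact hatt⟩
  have hx0 := (hleaves x hx).2
  have hxle := le_exact_of_mem_leaves _ (fun y hy => (hleaves y hy).2) x hx
  exact exists_toRat_eq_of_isFloat (hleaves x hx).1 (by rw [abs_of_nonneg hx0]; linarith)

/-- T7(d) in format `α`, the sequential tree: the attained factor `1 - 1/N_seq` equals the upper
bound `1 - 1/M_seq(v_α)` (`treeN_seqTree`), so whenever the witness fits the range the exact worst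
case of recursive truncated summation of `n` nonnegative `α`-values is `(n-1)v_α/(1 + (n-1)v_α)`,
`v_α = 2u_α - 2u_α²` — e.g. in bfloat16 `v = 255/32768`. -/
theorem rz_sequential_factor (α : Format) (n : ℕ) (hn : 1 ≤ n) :
    treeN (unitRoundoff (α.manBits + 1)) (seqTree n) = treeM (rzUnit (α.manBits + 1)) (seqTree n) ∧
    treeM (rzUnit (α.manBits + 1)) (seqTree n) = 1 + ((n : ℚ) - 1) * rzUnit (α.manBits + 1) :=
  ⟨treeN_seqTree _ n hn, treeM_seqTree (rzUnit_nonneg _) n hn⟩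

/-! ## Height table: for which trees does the RZ witness fit the format? -/

/-- `N_t(u) ≤ 2(1+u)^height − 1` (`0 ≤ u ≤ 1`). -/
theorem treeN_le_of_height {u : ℚ} (hu0 : 0 ≤ u) (t : SumTree) :
    treeN u t ≤ 2 * (1 + u) ^ height t - 1 := by
  unfold treeN
  have h1 := treeM_le_pow_height hu0 t
  have h2 := one_le_treeM hu0 t
  nlinarith

/-- Generic height form of T7(c) in a format, at the lowest admissible scale
`2^E`, `E = qexp + p(H+1) - 1`: if `2^E·(2(1+u)^H − 1) ≤ maxRat α` then for EVERY tree of height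
`≤ H` there is nonnegative `α`-data of the same tree polynomials, positive sum, on which the
format's round-toward-zero evaluation under-estimates by exactly `(1 − 1/N_t(u_α))·exact`. -/
theorem rz_attained_of_height_le (α : Format) (H : ℕ)
    (hfit : (2 : ℚ) ^ (α.qexp + ((α.manBits + 1 : ℕ) : ℤ) * ((H + 1 : ℕ) : ℤ) - 1)
      * (2 * (1 + unitRoundoff (α.manBits + 1)) ^ H - 1) ≤ α.maxRat)
    (t : SumTree) (ht : height t ≤ H) :
    ∃ w : SumTree, treeM (unitRoundoff (α.manBits + 1)) w = treeM (unitRoundoff (α.manBits + 1)) t ∧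
      treeM (rzUnit (α.manBits + 1)) w = treeM (rzUnit (α.manBits + 1)) t ∧
      (∀ x ∈ leaves w, (∃ y : MiniFloat α, y.toRat = x) ∧ 0 ≤ x) ∧ 0 < exact w ∧
      exact w - eval (fun y => (roundTowardZero α y).toRat) w
        = (1 - 1 / treeN (unitRoundoff (α.manBits + 1)) t) * exact w := by
  set u := unitRoundoff (α.manBits + 1) with hu
  set E : ℤ := α.qexp + ((α.manBits + 1 : ℕ) : ℤ) * ((H + 1 : ℕ) : ℤ) - 1 with hEdef
  have hu0 : 0 ≤ u := unitRoundoff_nonneg _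
  have hu1 : u ≤ 1 := unitRoundoff_le_one _
  have hN1 := one_le_treeN hu0 hu1 t
  have hE : α.qexp + ((α.manBits + 1 : ℕ) : ℤ) * ((height t + 1 : ℕ) : ℤ) ≤ E + 1 := by
    have : ((height t + 1 : ℕ) : ℤ) ≤ ((H + 1 : ℕ) : ℤ) := by exact_mod_cast Nat.succ_le_succ ht
    rw [hEdef]; nlinarith
  have hN : treeN u t ≤ 2 * (1 + u) ^ H - 1 :=
    le_trans (treeN_le_of_height hu0 t)
      (by nlinarith [pow_le_pow_right₀ (by linarith : (1:ℚ) ≤ 1 + u) ht])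
  have hrange : (2 : ℚ) ^ E * treeN u t ≤ α.maxRat :=
    le_trans (mul_le_mul_of_nonneg_left hN (le_of_lt (zpow_pos (by norm_num) _))) hfit
  obtain ⟨hleaves, hexact, -, hatt⟩ := rz_witness_attains_format α t hE hrange
  refine ⟨_, treeM_witRZ _ _ _ t, treeM_witRZ _ _ _ t, hleaves, ?_, hatt⟩
  rw [hexact]; exact mul_pos (zpow_pos (by norm_num) _) (by linarith)

/-- E4M3: the RZ witness fits for every tree of height `≤ 3` (scale `2^6`, `N ≤ 2(17/16)³ − 1`). -/
theorem rz_attained_E4M3 (t : SumTree) (ht : height t ≤ 3) :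
    ∃ w : SumTree, treeM (unitRoundoff (Format.E4M3.manBits + 1)) w = treeM (unitRoundoff (Format.E4M3.manBits + 1)) t ∧
      treeM (rzUnit (Format.E4M3.manBits + 1)) w = treeM (rzUnit (Format.E4M3.manBits + 1)) t ∧
      (∀ x ∈ leaves w, (∃ y : MiniFloat Format.E4M3, y.toRat = x) ∧ 0 ≤ x) ∧ 0 < exact w ∧
      exact w - eval (fun y => (roundTowardZero Format.E4M3 y).toRat) w
        = (1 - 1 / treeN (unitRoundoff (Format.E4M3.manBits + 1)) t) * exact w :=
  rz_attained_of_height_le Format.E4M3 3 (by decide +kernel) t ht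

/-- E5M2: height `≤ 9`. -/
theorem rz_attained_E5M2 (t : SumTree) (ht : height t ≤ 9) :
    ∃ w : SumTree, treeM (unitRoundoff (Format.E5M2.manBits + 1)) w = treeM (unitRoundoff (Format.E5M2.manBits + 1)) t ∧
      treeM (rzUnit (Format.E5M2.manBits + 1)) w = treeM (rzUnit (Format.E5M2.manBits + 1)) t ∧
      (∀ x ∈ leaves w, (∃ y : MiniFloat Format.E5M2, y.toRat = x) ∧ 0 ≤ x) ∧ 0 < exact w ∧
      exact w - eval (fun y => (roundTowardZero Format.E5M2 y).toRat) w
        = (1 - 1 / treeN (unitRoundoff (Format.E5M2.manBits + 1)) t) * exact w :=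
  rz_attained_of_height_le Format.E5M2 9 (by decide +kernel) t ht

/-- E3M2: height `≤ 2`. -/
theorem rz_attained_E3M2 (t : SumTree) (ht : height t ≤ 2) :
    ∃ w : SumTree, treeM (unitRoundoff (Format.E3M2.manBits + 1)) w = treeM (unitRoundoff (Format.E3M2.manBits + 1)) t ∧
      treeM (rzUnit (Format.E3M2.manBits + 1)) w = treeM (rzUnit (Format.E3M2.manBits + 1)) t ∧
      (∀ x ∈ leaves w, (∃ y : MiniFloat Format.E3M2, y.toRat = x) ∧ 0 ≤ x) ∧ 0 < exact w ∧
      exact w - eval (fun y => (roundTowardZero Format.E3M2 y).toRat) w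
        = (1 - 1 / treeN (unitRoundoff (Format.E3M2.manBits + 1)) t) * exact w :=
  rz_attained_of_height_le Format.E3M2 2 (by decide +kernel) t ht

/-- E2M1 (FP4): height `≤ 1` — the two-leaf witness `(4, 3/2) ↦ rz(11/2) = 4`. -/
theorem rz_attained_E2M1 (t : SumTree) (ht : height t ≤ 1) :
    ∃ w : SumTree, treeM (unitRoundoff (Format.E2M1.manBits + 1)) w = treeM (unitRoundoff (Format.E2M1.manBits + 1)) t ∧
      treeM (rzUnit (Format.E2M1.manBits + 1)) w = treeM (rzUnit (Format.E2M1.manBits + 1)) t ∧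
      (∀ x ∈ leaves w, (∃ y : MiniFloat Format.E2M1, y.toRat = x) ∧ 0 ≤ x) ∧ 0 < exact w ∧
      exact w - eval (fun y => (roundTowardZero Format.E2M1 y).toRat) w
        = (1 - 1 / treeN (unitRoundoff (Format.E2M1.manBits + 1)) t) * exact w :=
  rz_attained_of_height_le Format.E2M1 1 (by decide +kernel) t ht

/-- binary16: height `≤ 2` (exponent range binding). -/
theorem rz_attained_Binary16 (t : SumTree) (ht : height t ≤ 2) :
    ∃ w : SumTree, treeM (unitRoundoff (Format.Binary16.manBits + 1)) w = treeM (unitRoundoff (Format.Binary16.manBits + 1)) t ∧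
      treeM (rzUnit (Format.Binary16.manBits + 1)) w = treeM (rzUnit (Format.Binary16.manBits + 1)) t ∧
      (∀ x ∈ leaves w, (∃ y : MiniFloat Format.Binary16, y.toRat = x) ∧ 0 ≤ x) ∧ 0 < exact w ∧
      exact w - eval (fun y => (roundTowardZero Format.Binary16 y).toRat) w
        = (1 - 1 / treeN (unitRoundoff (Format.Binary16.manBits + 1)) t) * exact w :=
  rz_attained_of_height_le Format.Binary16 2 (by decide +kernel) t ht

/-- bfloat16: height `≤ 31`. -/
theorem rz_attained_BFloat16 (t : SumTree) (ht : height t ≤ 31) :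
    ∃ w : SumTree, treeM (unitRoundoff (Format.BFloat16.manBits + 1)) w = treeM (unitRoundoff (Format.BFloat16.manBits + 1)) t ∧
      treeM (rzUnit (Format.BFloat16.manBits + 1)) w = treeM (rzUnit (Format.BFloat16.manBits + 1)) t ∧
      (∀ x ∈ leaves w, (∃ y : MiniFloat Format.BFloat16, y.toRat = x) ∧ 0 ≤ x) ∧ 0 < exact w ∧
      exact w - eval (fun y => (roundTowardZero Format.BFloat16 y).toRat) w
        = (1 - 1 / treeN (unitRoundoff (Format.BFloat16.manBits + 1)) t) * exact w :=
  rz_attained_of_height_le Format.BFloat16 31 (by decide +kernel) t ht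

/-- binary32: height `≤ 10`. -/
theorem rz_attained_Binary32 (t : SumTree) (ht : height t ≤ 10) :
    ∃ w : SumTree, treeM (unitRoundoff (Format.Binary32.manBits + 1)) w = treeM (unitRoundoff (Format.Binary32.manBits + 1)) t ∧
      treeM (rzUnit (Format.Binary32.manBits + 1)) w = treeM (rzUnit (Format.Binary32.manBits + 1)) t ∧
      (∀ x ∈ leaves w, (∃ y : MiniFloat Format.Binary32, y.toRat = x) ∧ 0 ≤ x) ∧ 0 < exact w ∧
      exact w - eval (fun y => (roundTowardZero Format.Binary32 y).toRat) w
        = (1 - 1 / treeN (unitRoundoff (Format.Binary32.manBits + 1)) t) * exact w :=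
  rz_attained_of_height_le Format.Binary32 10 (by decide +kernel) t ht

/-- The table rows are ceilings for this (lowest-scale) witness, and E2M3 has no row: one more
unit of height (E4M3 `4`, E2M1 `2`), resp. already height `1` in E2M3, violates the fit
(kernel arithmetic). -/
theorem rz_height_table_ceilings :
    ¬ ((2 : ℚ) ^ (Format.E4M3.qexp + ((Format.E4M3.manBits + 1 : ℕ) : ℤ) * ((4 + 1 : ℕ) : ℤ) - 1)
        * (2 * (1 + unitRoundoff (Format.E4M3.manBits + 1)) ^ 4 - 1) ≤ Format.E4M3.maxRat) ∧
    ¬ ((2 : ℚ) ^ (Format.E2M1.qexp + ((Format.E2M1.manBits + 1 : ℕ) : ℤ) * ((2 + 1 : ℕ) : ℤ) - 1)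
        * (2 * (1 + unitRoundoff (Format.E2M1.manBits + 1)) ^ 2 - 1) ≤ Format.E2M1.maxRat) ∧
    ¬ ((2 : ℚ) ^ (Format.E2M3.qexp + ((Format.E2M3.manBits + 1 : ℕ) : ℤ) * ((1 + 1 : ℕ) : ℤ) - 1)
        * (2 * (1 + unitRoundoff (Format.E2M3.manBits + 1)) ^ 1 - 1) ≤ Format.E2M3.maxRat) := by
  refine ⟨by decide +kernel, by decide +kernel, by decide +kernel⟩

/-- Kernel replay (E4M3, `u = 1/16`, `v = 15/128`): the two-leaf witness `(32, 15/4)`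
(`15/4 = (2-2u)·u·32`) truncates to `32` — a full absorption losing exactly the fraction
`v/(1+v) = 15/143` of the sum `143/4`; and `rzUnit 4 = 15/128`. -/
example : (roundTowardZero Format.E4M3 ((32 : ℚ) + 15 / 4)).toRat = 32 ∧ rzUnit 4 = 15 / 128 := by
  refine ⟨by decide +kernel, ?_⟩
  rw [rzUnit]; unfold unitRoundoff; norm_num

end Summit.Ventures.CertifiedArithmetic.LowPrec.Opt
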